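import Literature.Computability.Cryptography.WordRAM
import Literature.Computability.Cryptography.WordRAMExec
import Literature.Computability.Cryptography.WordRAMReads
import HarnessLib

/-!
# The word RAM — canonical read sets: an oracle-free run is an adaptive decision tree over its
# input cells

Companion of `Literature.Computability.Cryptography.WordRAMReads` (a `t`-step oracle-free run
reads at most `5t` cells, stated there with an *existential* set of addresses). For lower bounds
against randomized sublinear-time algorithms by *indistinguishability* (a `k`-wise independent
family of inputs versus a uniformly random input) the existential form is not enough: one needs
the read set as a FUNCTION of the run which is *stable* — an input agreeing with `x` on the cells
read by the run on `x` is read in exactly the same cells — so that the cube of inputs is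
partitioned into cylinders on which the run is constant (the "adaptive decision tree of depth
`5t`" picture). This file supplies that form, by the same case analysis of `step` and induction
along `run` as the companion file:

* `Operand.readSet`, `Operand.writeReadSet`, `instrReadSet`, `stepReadSet P c` — the (at most
  `5`) cells one step reads, as a function of the configuration; `step_congr_of_stepReadSet`:
  a configuration with the same control state (`pc`, `coinPos`) whose memory agrees with `c.mem`
  on `stepReadSet P c` has THE SAME step read set, steps alike, and agreement of the memories at
  any cell is preserved;
* `runReadSet P w O ρ n c` — the cells read along `n` steps (card `≤ 5n`, monotone in `n`);
  `run_congr_of_runReadSet`: same, along runs, including equality of the two run read sets;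
* `inputReadSet P w O ρ t x` — the cells read by the run of at most `t` steps on input `x`;
  `inputReadSet_congr` (**stability**: an input of the same length agreeing with `x` at every
  input word whose cell is read has the same read set) and `OutputsWithin.of_inputReadSet` /
  `outputsWithin_iff_of_inputReadSet` (**determination**: it produces the same output within the
  same time; differing words must lie beyond the output segment, as in the companion file).

Oracle-free programs only (a `query` reads a whole segment); same word size, oracle argument and
coin stream on both sides, so the statements apply coin-stream-wise to randomized programs.

## References

* T. Hagerup, *Sorting and searching on the word RAM*, STACS 1998, §2 (one instruction accesses
  `O(1)` words).
* The decision-tree view of RAM computations on the input / unread-cell arguments: folklore.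
-/

namespace Literature.Computability.Cryptography.WordRAM

open StateTransition

/-! ## Operands -/

/-- The cells read when evaluating an operand in memory `mem` (`imm`: none; `dir a`: `a`;
`ind a`: `a` and `mem a`). [folklore] -/
def Operand.readSet (mem : ℕ → ℕ) : Operand → Finset ℕ
  | .imm _ => ∅
  | .dir a => {a}
  | .ind a => {a, mem a}

/-- The cells read to determine the address written through an operand (`ind a`: `a`; otherwise
none). [folklore] -/
def Operand.writeReadSet : Operand → Finset ℕ
  | .imm _ => ∅
  | .dir _ => ∅
  | .ind a => {a}

/-- An operand reads at most two cells. [folklore] -/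
theorem Operand.card_readSet_le (o : Operand) (mem : ℕ → ℕ) : (o.readSet mem).card ≤ 2 := by
  cases o with
  | imm c => simp [Operand.readSet]
  | dir a => simp [Operand.readSet]
  | ind a => exact Finset.card_le_two

/-- The write address of an operand depends on at most one cell. [folklore] -/
theorem Operand.card_writeReadSet_le (o : Operand) : o.writeReadSet.card ≤ 1 := by
  cases o <;> simp [Operand.writeReadSet]

/-- A memory agreeing with `mem₁` on the read set of an operand reads the same value AND has the
same read set. [folklore] -/
theorem Operand.read_congr_of_readSet (o : Operand) {mem₁ mem₂ : ℕ → ℕ}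
    (h : ∀ a ∈ o.readSet mem₁, mem₂ a = mem₁ a) :
    o.read mem₂ = o.read mem₁ ∧ o.readSet mem₂ = o.readSet mem₁ := by
  cases o with
  | imm c => exact ⟨rfl, rfl⟩
  | dir a => exact ⟨h a (by simp [Operand.readSet]), rfl⟩
  | ind a =>
    have ha : mem₂ a = mem₁ a := h a (by simp [Operand.readSet])
    refine ⟨?_, ?_⟩
    · show mem₂ (mem₂ a) = mem₁ (mem₁ a)
      rw [ha, h (mem₁ a) (by simp [Operand.readSet])]
    · show ({a, mem₂ a} : Finset ℕ) = {a, mem₁ a}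
      rw [ha]

/-- If two memories agree on the write-read set of an operand, writing the same value through the
operand preserves agreement of the memories at every cell. [folklore] -/
theorem Operand.write_congr_of_writeReadSet (o : Operand) {mem₁ mem₂ : ℕ → ℕ}
    (h : ∀ a ∈ o.writeReadSet, mem₂ a = mem₁ a) :
    ∀ v b : ℕ, mem₂ b = mem₁ b → o.write mem₂ v b = o.write mem₁ v b := by
  cases o with
  | imm c => exact fun v b hb => by simpa using hb
  | dir a =>
    intro v b hb
    show Function.update mem₂ a v b = Function.update mem₁ a v b
    rcases eq_or_ne b a with rfl | hba
    · simp
    · rw [Function.update_of_ne hba, Function.update_of_ne hba, hb]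
  | ind a =>
    have ha : mem₂ a = mem₁ a := h a (by simp [Operand.writeReadSet])
    intro v b hb
    show Function.update mem₂ (mem₂ a) v b = Function.update mem₁ (mem₁ a) v b
    rw [ha]
    rcases eq_or_ne b (mem₁ a) with rfl | hba
    · simp
    · rw [Function.update_of_ne hba, Function.update_of_ne hba, hb]

/-! ## One step -/

/-- The cells read by an instruction in memory `mem` (`op o dst x y`: the cells of `x`, `y` and the
address cell of `dst`; `jz x t`: the cells of `x`; `rand dst`: the address cell of `dst`; `jmp`,
`halt`: none; `query`: none recorded — the statements below assume oracle-free programs). [folklore] -/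
def instrReadSet (mem : ℕ → ℕ) : Instr → Finset ℕ
  | .op _ dst x y => x.readSet mem ∪ y.readSet mem ∪ dst.writeReadSet
  | .jz x _ => x.readSet mem
  | .rand dst => dst.writeReadSet
  | .jmp _ => ∅
  | .query _ _ _ => ∅
  | .halt => ∅

/-- An instruction reads at most five cells. [folklore] -/
theorem card_instrReadSet_le (mem : ℕ → ℕ) (I : Instr) : (instrReadSet mem I).card ≤ 5 := by
  cases I with
  | op o dst x y =>
    calc (x.readSet mem ∪ y.readSet mem ∪ dst.writeReadSet).card
        ≤ (x.readSet mem ∪ y.readSet mem).card + dst.writeReadSet.card :=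
          Finset.card_union_le _ _
      _ ≤ ((x.readSet mem).card + (y.readSet mem).card) + dst.writeReadSet.card := by
          gcongr; exact Finset.card_union_le _ _
      _ ≤ (2 + 2) + 1 := by
          gcongr
          · exact x.card_readSet_le mem
          · exact y.card_readSet_le mem
          · exact dst.card_writeReadSet_le
  | jz x t => exact (x.card_readSet_le mem).trans (Nat.le_add_left 2 3)
  | rand dst => exact dst.card_writeReadSet_le.trans (Nat.le_add_left 1 4)
  | jmp t => simp [instrReadSet]
  | query qa ql aa => simp [instrReadSet]
  | halt => simp [instrReadSet]

/-- **The step read set**: the cells read by one step of `P` from configuration `c` (empty if `c`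
is halted or the program counter is outside `P`). [folklore] -/
def stepReadSet (P : Program) (c : Cfg) : Finset ℕ :=
  match c.pc with
  | none => ∅
  | some i =>
    match P[i]? with
    | none => ∅
    | some I => instrReadSet c.mem I

/-- A halted configuration reads nothing. [folklore] -/
theorem stepReadSet_of_pc_eq_none {P : Program} {c : Cfg} (h : c.pc = none) :
    stepReadSet P c = ∅ := by
  simp [stepReadSet, h]

/-- The step read set at program counter `i`. [folklore] -/
theorem stepReadSet_of_getElem? {P : Program} {c : Cfg} {i : ℕ} (h : c.pc = some i) :
    stepReadSet P c = match P[i]? with | none => ∅ | some I => instrReadSet c.mem I := by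
  simp [stepReadSet, h]

/-- One step reads at most five cells. [folklore] -/
theorem card_stepReadSet_le (P : Program) (c : Cfg) : (stepReadSet P c).card ≤ 5 := by
  cases hpc : c.pc with
  | none => simp [stepReadSet_of_pc_eq_none hpc]
  | some i =>
    rw [stepReadSet_of_getElem? hpc]
    split
    · simp
    · exact card_instrReadSet_le _ _

/-- **One step is determined by, and stable on, its read set.** For an oracle-free program: a
configuration `c₂` with the program counter and coin position of `c₁` whose memory agrees with
`c₁.mem` on `stepReadSet P c₁` has the same step read set; and if `c₁` steps to `d₁` then `c₂`
steps to some `d₂` with the program counter and coin position of `d₁`, every cell at which the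
memories of `c₁`, `c₂` agree being a cell at which those of `d₁`, `d₂` agree. [folklore] -/
theorem step_congr_of_stepReadSet {P : Program} (hP : P.IsOracleFree) (w : ℕ)
    (O : List ℕ → List ℕ) (ρ : ℕ → ℕ) {c₁ c₂ : Cfg} (hpc : c₂.pc = c₁.pc)
    (hcoin : c₂.coinPos = c₁.coinPos) (hmem : ∀ a ∈ stepReadSet P c₁, c₂.mem a = c₁.mem a) :
    stepReadSet P c₂ = stepReadSet P c₁ ∧
      ∀ d₁ : Cfg, step P w O ρ c₁ = some d₁ → ∃ d₂ : Cfg, step P w O ρ c₂ = some d₂ ∧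
        d₂.pc = d₁.pc ∧ d₂.coinPos = d₁.coinPos ∧
        ∀ b, c₂.mem b = c₁.mem b → d₂.mem b = d₁.mem b := by
  cases hpc₁ : c₁.pc with
  | none =>
    have hpc₂ : c₂.pc = none := hpc.trans hpc₁
    refine ⟨by rw [stepReadSet_of_pc_eq_none hpc₁, stepReadSet_of_pc_eq_none hpc₂],
      fun d₁ hd₁ => ?_⟩
    rw [step_of_pc_eq_none hpc₁] at hd₁
    exact absurd hd₁ (by simp)
  | some i =>
    have hpc₂ : c₂.pc = some i := hpc.trans hpc₁
    rw [stepReadSet_of_getElem? hpc₁] at hmem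
    rw [stepReadSet_of_getElem? hpc₁, stepReadSet_of_getElem? hpc₂]
    cases hI : P[i]? with
    | none =>
      refine ⟨rfl, fun d₁ hd₁ => ?_⟩
      rw [step_of_getElem?_eq_none hpc₁ hI, Option.some.injEq] at hd₁
      subst hd₁
      exact ⟨_, step_of_getElem?_eq_none hpc₂ hI, rfl, hcoin, fun b hb => hb⟩
    | some I =>
      rw [hI] at hmem
      simp only at hmem ⊢
      cases I with
      | halt =>
        refine ⟨rfl, fun d₁ hd₁ => ?_⟩
        rw [step_halt hpc₁ hI, Option.some.injEq] at hd₁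
        subst hd₁
        exact ⟨_, step_halt hpc₂ hI, rfl, hcoin, fun b hb => hb⟩
      | jmp t =>
        refine ⟨rfl, fun d₁ hd₁ => ?_⟩
        rw [step_jmp hpc₁ hI, Option.some.injEq] at hd₁
        subst hd₁
        exact ⟨_, step_jmp hpc₂ hI, rfl, hcoin, fun b hb => hb⟩
      | jz x t =>
        obtain ⟨hxr, hxs⟩ := x.read_congr_of_readSet (mem₁ := c₁.mem) (mem₂ := c₂.mem) hmem
        refine ⟨hxs, fun d₁ hd₁ => ?_⟩
        rw [step_jz hpc₁ hI, Option.some.injEq] at hd₁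
        subst hd₁
        refine ⟨_, step_jz hpc₂ hI, ?_, hcoin, fun b hb => hb⟩
        show (if x.read c₂.mem = 0 then some t else some (i + 1)) =
          if x.read c₁.mem = 0 then some t else some (i + 1)
        rw [hxr]
      | op o dst x y =>
        obtain ⟨hxr, hxs⟩ := x.read_congr_of_readSet (mem₁ := c₁.mem) (mem₂ := c₂.mem)
          fun a ha => hmem a (by simp [instrReadSet, ha])
        obtain ⟨hyr, hys⟩ := y.read_congr_of_readSet (mem₁ := c₁.mem) (mem₂ := c₂.mem)
          fun a ha => hmem a (by simp [instrReadSet, ha])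
        have hd := dst.write_congr_of_writeReadSet (mem₁ := c₁.mem) (mem₂ := c₂.mem)
          fun a ha => hmem a (by simp [instrReadSet, ha])
        refine ⟨by simp only [instrReadSet, hxs, hys], fun d₁ hd₁ => ?_⟩
        rw [step_op hpc₁ hI, Option.some.injEq] at hd₁
        subst hd₁
        refine ⟨_, step_op hpc₂ hI, rfl, hcoin, fun b hb => ?_⟩
        show dst.write c₂.mem (o.eval w (x.read c₂.mem) (y.read c₂.mem)) b =
          dst.write c₁.mem (o.eval w (x.read c₁.mem) (y.read c₁.mem)) b
        rw [hxr, hyr]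
        exact hd _ b hb
      | rand dst =>
        have hd := dst.write_congr_of_writeReadSet (mem₁ := c₁.mem) (mem₂ := c₂.mem)
          fun a ha => hmem a (by simpa [instrReadSet] using ha)
        refine ⟨rfl, fun d₁ hd₁ => ?_⟩
        rw [step_rand hpc₁ hI, Option.some.injEq] at hd₁
        subst hd₁
        refine ⟨_, step_rand hpc₂ hI, rfl, by simp [hcoin], fun b hb => ?_⟩
        show dst.write c₂.mem (ρ c₂.coinPos % 2 ^ w) b = dst.write c₁.mem (ρ c₁.coinPos % 2 ^ w) b
        rw [hcoin]
        exact hd _ b hb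
      | query qa ql aa =>
        exact absurd (hP _ (List.mem_of_getElem? hI)) (by simp [Instr.isQuery])

/-! ## Whole runs -/

/-- **The run read set**: the cells read along `n` steps of `P` (word size `w`, oracle `O`, coins
`ρ`) from `c` — the step read sets of the configurations passed through, nothing after halting. [folklore] -/
def runReadSet (P : Program) (w : ℕ) (O : List ℕ → List ℕ) (ρ : ℕ → ℕ) : ℕ → Cfg → Finset ℕ
  | 0, _ => ∅
  | n + 1, c => stepReadSet P c ∪
      match step P w O ρ c with
      | none => ∅
      | some d => runReadSet P w O ρ n d

section run

variable (P : Program) (w : ℕ) (O : List ℕ → List ℕ) (ρ : ℕ → ℕ)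

/-- Zero steps read nothing. [folklore] -/
@[simp] theorem runReadSet_zero (c : Cfg) : runReadSet P w O ρ 0 c = ∅ := rfl

/-- One more step, taken first, from a configuration whose successor is known. [folklore] -/
theorem runReadSet_succ_of_step {c d : Cfg} (h : step P w O ρ c = some d) (n : ℕ) :
    runReadSet P w O ρ (n + 1) c = stepReadSet P c ∪ runReadSet P w O ρ n d := by
  simp [runReadSet, h]

/-- A halted configuration reads only its (empty) step read set. [folklore] -/
theorem runReadSet_succ_of_step_eq_none {c : Cfg} (h : step P w O ρ c = none) (n : ℕ) :
    runReadSet P w O ρ (n + 1) c = stepReadSet P c := by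
  simp [runReadSet, h]

/-- `n` steps read at most `5 n` cells. [folklore] -/
theorem card_runReadSet_le : ∀ (n : ℕ) (c : Cfg), (runReadSet P w O ρ n c).card ≤ 5 * n
  | 0, c => by simp
  | n + 1, c => by
    cases h : step P w O ρ c with
    | none =>
      rw [runReadSet_succ_of_step_eq_none P w O ρ h]
      exact (card_stepReadSet_le P c).trans (by omega)
    | some d =>
      rw [runReadSet_succ_of_step P w O ρ h]
      exact (Finset.card_union_le _ _).trans
        (by have := card_stepReadSet_le P c; have := card_runReadSet_le n d; omega)

/-- The run read set grows with the number of steps. [folklore] -/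
theorem runReadSet_subset_succ : ∀ (n : ℕ) (c : Cfg),
    runReadSet P w O ρ n c ⊆ runReadSet P w O ρ (n + 1) c
  | 0, c => by simp
  | n + 1, c => by
    cases h : step P w O ρ c with
    | none =>
      rw [runReadSet_succ_of_step_eq_none P w O ρ h, runReadSet_succ_of_step_eq_none P w O ρ h]
    | some d =>
      rw [runReadSet_succ_of_step P w O ρ h, runReadSet_succ_of_step P w O ρ h]
      exact Finset.union_subset_union (le_refl _) (runReadSet_subset_succ n d)

/-- The run read set is monotone in the number of steps. [folklore] -/
theorem runReadSet_mono {m n : ℕ} (hmn : m ≤ n) (c : Cfg) :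
    runReadSet P w O ρ m c ⊆ runReadSet P w O ρ n c := by
  induction hmn with
  | refl => exact le_refl _
  | step _ ih => exact ih.trans (runReadSet_subset_succ P w O ρ _ c)

end run

/-- **A run is determined by, and stable on, its read set.** For an oracle-free program, `n : ℕ`
and configurations `c₁`, `c₂` with the same program counter and coin position whose memories agree
on `runReadSet … n c₁`: the two run read sets coincide, and if `c₁` reaches `c₁'` in exactly `n`
steps then `c₂` reaches in exactly `n` steps some `c₂'` with the program counter and coin position
of `c₁'`, agreement of the memories at any cell being preserved. [folklore] -/
theorem run_congr_of_runReadSet {P : Program} (hP : P.IsOracleFree) (w : ℕ)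
    (O : List ℕ → List ℕ) (ρ : ℕ → ℕ) :
    ∀ (n : ℕ) (c₁ c₂ : Cfg), c₂.pc = c₁.pc → c₂.coinPos = c₁.coinPos →
      (∀ a ∈ runReadSet P w O ρ n c₁, c₂.mem a = c₁.mem a) →
      runReadSet P w O ρ n c₂ = runReadSet P w O ρ n c₁ ∧
        ∀ c₁' : Cfg, run P w O ρ n c₁ = some c₁' → ∃ c₂' : Cfg, run P w O ρ n c₂ = some c₂' ∧
          c₂'.pc = c₁'.pc ∧ c₂'.coinPos = c₁'.coinPos ∧
          ∀ b, c₂.mem b = c₁.mem b → c₂'.mem b = c₁'.mem b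
  | 0, c₁, c₂, hpc, hcoin, _ => by
      refine ⟨rfl, fun c₁' h => ?_⟩
      simp only [run_zero, Option.some.injEq] at h
      subst h
      exact ⟨c₂, run_zero _ _ _ _ _, hpc, hcoin, fun b hb => hb⟩
  | n + 1, c₁, c₂, hpc, hcoin, hmem => by
      have hmem₁ : ∀ a ∈ stepReadSet P c₁, c₂.mem a = c₁.mem a := fun a ha => hmem a (by
        cases hs : step P w O ρ c₁ with
        | none => rw [runReadSet_succ_of_step_eq_none P w O ρ hs]; exact ha
        | some d => rw [runReadSet_succ_of_step P w O ρ hs]; exact Finset.mem_union_left _ ha)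
      obtain ⟨hstepSet, hstep⟩ := step_congr_of_stepReadSet hP w O ρ hpc hcoin hmem₁
      cases hs : step P w O ρ c₁ with
      | none =>
        have hs₂ : step P w O ρ c₂ = none := by
          rw [step_eq_none_iff] at hs ⊢
          exact hpc.trans hs
        refine ⟨by rw [runReadSet_succ_of_step_eq_none P w O ρ hs,
          runReadSet_succ_of_step_eq_none P w O ρ hs₂, hstepSet], fun c₁' h => ?_⟩
        rw [run_succ_of_step_eq_none P w O ρ hs] at h
        exact absurd h (by simp)
      | some d₁ =>
        obtain ⟨d₂, hd₂, hpc', hcoin', hagree⟩ := hstep d₁ hs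
        have hmem' : ∀ a ∈ runReadSet P w O ρ n d₁, d₂.mem a = d₁.mem a := fun a ha =>
          hagree a (hmem a (by
            rw [runReadSet_succ_of_step P w O ρ hs]
            exact Finset.mem_union_right _ ha))
        obtain ⟨hrunSet, hrun⟩ := run_congr_of_runReadSet hP w O ρ n d₁ d₂ hpc' hcoin' hmem'
        refine ⟨by rw [runReadSet_succ_of_step P w O ρ hs, runReadSet_succ_of_step P w O ρ hd₂,
          hstepSet, hrunSet], fun c₁' h => ?_⟩
        rw [run_succ_of_step P w O ρ hs] at h
        obtain ⟨c₂', hc₂', hpc'', hcoin'', hagree'⟩ := hrun c₁' h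
        refine ⟨c₂', ?_, hpc'', hcoin'', fun b hb => hagree' b (hagree b hb)⟩
        rw [run_succ_of_step P w O ρ hd₂]
        exact hc₂'

/-! ## Inputs: the read set of the run on an input -/

/-- **The input read set**: the cells read by the run of at most `t` steps of `P` (word size `w`,
oracle `O`, coins `ρ`) started on input `x` (cell `i + 1` holds input word `i`, cell `0` the
length). [folklore] -/
def inputReadSet (P : Program) (w : ℕ) (O : List ℕ → List ℕ) (ρ : ℕ → ℕ) (t : ℕ) (x : List ℕ) :
    Finset ℕ :=
  runReadSet P w O ρ t (init w x)

/-- A run of at most `t` steps reads at most `5 t` cells. [folklore] -/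
theorem card_inputReadSet_le (P : Program) (w : ℕ) (O : List ℕ → List ℕ) (ρ : ℕ → ℕ) (t : ℕ)
    (x : List ℕ) : (inputReadSet P w O ρ t x).card ≤ 5 * t :=
  card_runReadSet_le P w O ρ t _

/-- **Stability.** For an oracle-free program, an input `x₂` of the same length as `x` that agrees
with `x` at every input word whose cell is read by the run on `x` is read in exactly the same
cells. [folklore] -/
theorem inputReadSet_congr {P : Program} (hP : P.IsOracleFree) {w : ℕ} {O : List ℕ → List ℕ}
    {ρ : ℕ → ℕ} {t : ℕ} {x x₂ : List ℕ} (hlen : x₂.length = x.length)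
    (h : ∀ i, i + 1 ∈ inputReadSet P w O ρ t x → x₂[i]? = x[i]?) :
    inputReadSet P w O ρ t x₂ = inputReadSet P w O ρ t x :=
  (run_congr_of_runReadSet hP w O ρ t (init w x) (init w x₂) rfl rfl fun _ ha =>
    init_mem_congr w hlen fun i hi => h i (hi ▸ ha)).1

/-- **Determination.** For an oracle-free program, if `P` outputs `out` on `x` within `t` steps,
then it outputs `out` within `t` steps on every input `x₂` of the same length that agrees with `x`
at every input word whose cell is read by the run on `x` and whose words differing from `x` lie
beyond the output segment (`|out| ≤ i`; the output is read from cells `1, …, |out|`). Same word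
size, oracle argument and coins on both sides. [folklore] -/
theorem OutputsWithin.of_inputReadSet {P : Program} (hP : P.IsOracleFree) {w : ℕ}
    {O : List ℕ → List ℕ} {ρ : ℕ → ℕ} {x x₂ out : List ℕ} {t : ℕ}
    (hx : OutputsWithin P w O ρ x out t) (hlen : x₂.length = x.length)
    (hR : ∀ i, i + 1 ∈ inputReadSet P w O ρ t x → x₂[i]? = x[i]?)
    (hout : ∀ i, x₂[i]? ≠ x[i]? → out.length ≤ i) : OutputsWithin P w O ρ x₂ out t := by
  obtain ⟨c₁, ⟨e⟩, hc₁, hout₁⟩ := hx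
  have hrun₁ : run P w O ρ e.steps (init w x) = some c₁ := e.evals_in_steps
  have hagree : ∀ a, (∀ i, a = i + 1 → x₂[i]? ≠ x[i]? → False) →
      (init w x₂).mem a = (init w x).mem a := fun a ha =>
    init_mem_congr w hlen fun i hi => by_contra fun hne => ha i hi hne
  have hsub : runReadSet P w O ρ e.steps (init w x) ⊆ inputReadSet P w O ρ t x :=
    runReadSet_mono P w O ρ e.steps_le_m _
  obtain ⟨-, hrun⟩ := run_congr_of_runReadSet hP w O ρ e.steps (init w x) (init w x₂) rfl rfl
    fun a ha => hagree a fun i hi hne => hne (hR i (hi ▸ hsub ha))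
  obtain ⟨c₂, hc₂, hpc, -, hmem⟩ := hrun c₁ hrun₁
  have hhalt : step P w O ρ c₂ = none := by
    rw [step_eq_none_iff] at hc₁ ⊢
    rw [hpc, hc₁]
  have hout₂ : readOut c₂.mem = out := by
    have h0 : c₂.mem 0 = c₁.mem 0 := hmem 0 (hagree 0 fun i hi => absurd hi (by omega))
    rw [← hout₁]
    unfold readOut
    rw [h0]
    refine readSeg_congr fun j hj => hmem (1 + j) (hagree (1 + j) fun i hi hne => ?_)
    have hij : i = j := by omega
    subst hij
    have : (readOut c₁.mem).length = c₁.mem 0 := readOut_length _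
    rw [hout₁] at this
    exact absurd (hout i hne) (by omega)
  rw [← hout₂]
  exact outputsWithin_of_run hc₂ hhalt e.steps_le_m

/-- **Determination, symmetric form.** Under the hypotheses of `OutputsWithin.of_inputReadSet`
the two inputs produce the same outputs within the same time. [folklore] -/
theorem outputsWithin_iff_of_inputReadSet {P : Program} (hP : P.IsOracleFree) {w : ℕ}
    {O : List ℕ → List ℕ} {ρ : ℕ → ℕ} {x x₂ out : List ℕ} {t : ℕ} (hlen : x₂.length = x.length)
    (hR : ∀ i, i + 1 ∈ inputReadSet P w O ρ t x → x₂[i]? = x[i]?)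
    (hout : ∀ i, x₂[i]? ≠ x[i]? → out.length ≤ i) :
    OutputsWithin P w O ρ x₂ out t ↔ OutputsWithin P w O ρ x out t := by
  refine ⟨fun h => ?_, fun h => h.of_inputReadSet hP hlen hR hout⟩
  have hR' : ∀ i, i + 1 ∈ inputReadSet P w O ρ t x₂ → x[i]? = x₂[i]? := fun i hi =>
    (hR i (inputReadSet_congr hP hlen hR ▸ hi)).symm
  exact h.of_inputReadSet hP hlen.symm hR' fun i hne => hout i (Ne.symm hne)

end Literature.Computability.Cryptography.WordRAM
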